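import Mathlib.LinearAlgebra.Matrix.GeneralLinearGroup.Defs
import Mathlib.Topology.Algebra.Group.Basic
import Mathlib.Topology.Instances.Matrix
import Mathlib.Topology.Algebra.Constructions
import Mathlib.RingTheory.Idempotents
import HarnessLib

/-!
# `GL_n` over a ring with an idempotent: truncation and the direct product decomposition

Topic `LinearAlgebra/Matrix`; definitions (`truncMonoidHom`, `truncGL`, `truncGLEquiv`,
`truncGLContinuousEquiv`) and theorems, Mathlib only.

Let `R` be a commutative ring and `e ∈ R` an idempotent, so that `R = R e × R (1 - e)` and
`GL_n(R) = GL_n(R e) × GL_n(R (1 - e))`. Without leaving `R`, the two factors are realised inside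
`GL_n(R)` by the **truncations** `π_e(A) = e A + (1 - e) 1` and `π_{1-e}` (monoid homomorphisms of
`M_n(R)`, `truncMonoidHom`, hence of `GL_n(R)`, `truncGL`): `π_e ∘ π_e = π_e`,
`π_e ∘ π_{1-e} = 1`, `π_e(g) π_{1-e}(g) = g`, and `π_e(g)`, `π_{1-e}(h)` commute
(`truncGL_truncGL`, `truncGL_truncGL_one_sub`, `truncGL_mul_truncGL_one_sub`, `truncGL_comm`).
Hence `g ↦ (π_e g, π_{1-e} g)` is an isomorphism of `GL_n(R)` with the (internal direct) product
of the ranges of the two truncations, with inverse `(a, b) ↦ a b` (`truncGLEquiv`), and a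
topological-group isomorphism when `R` is a topological ring (`truncGLContinuousEquiv`; both
directions are polynomial in the matrix entries, so no open-mapping theorem is needed).

Purpose: for the adele ring `R = 𝔸_K` and `e` the idempotent adele which is `1` at the places
outside a finite set `S ∋ ∞` and `0` on `S`, the ranges are `GL_n(𝔸_K^S)` (matrices congruent to
`1` at `S`) and `GL_n(𝔸_{K,S})`, and `truncGLContinuousEquiv` is the decomposition
`GL_n(𝔸_K) ≅ GL_n(𝔸_{K,S}) × GL_n(𝔸_K^S)` of topological groups (Weil, *Basic Number Theory*,
Ch. IV §1) used to split Haar measures and global integrals over `GL_n(𝔸_K)` place by place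
(unfolding of Godement–Jacquet zeta integrals, decomposition of
`Literature.NumberTheory.Automorphic.godementJacquet_hasMeromorphicContinuation`). Mathlib has
the ring-level decomposition along idempotents in various guises but not this unit-group /
`GL_n` packaging (`lean search` for `Idempotent.*GeneralLinear`, `truncat.*GL`: nothing).
-/

noncomputable section

open Matrix

namespace Literature.LinearAlgebra.Matrix

section Trunc

variable {R : Type*} [CommRing R] {n : Type*} [Fintype n] [DecidableEq n]

/-- **Truncation at an idempotent.** For an idempotent `e` of a commutative ring `R`, the map
`A ↦ e A + (1 - e) 1` on `M_n(R)`: it keeps the "`e`-component" of `A` and replaces the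
"`(1-e)`-component" by the identity (for `R = R e × R (1 - e)` this is `(A₁, A₂) ↦ (A₁, 1)`). It is
a monoid homomorphism (`e (1 - e) = 0`). For the adele ring and `e` the idele-free idempotent
supported off a finite set `T` of places this is the projection `g ↦ (g^T, 1_T)` of `GL_n(𝔸)` onto
the factor `GL_n(𝔸^T)` (Weil, *Basic Number Theory*, Ch. IV §1). [folklore] -/
def truncMonoidHom {e : R} (he : IsIdempotentElem e) : Matrix n n R →* Matrix n n R where
  toFun A := e • A + (1 - e) • (1 : Matrix n n R)
  map_one' := by rw [← add_smul, add_sub_cancel, one_smul]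
  map_mul' A B := by
    have h1 : e * (1 - e) = 0 := by rw [mul_sub, mul_one, he.eq, sub_self]
    have h2 : (1 - e) * e = 0 := by rw [mul_comm, h1]
    have h3 : (1 - e) * (1 - e) = 1 - e := (he.one_sub).eq
    simp only [add_mul, mul_add, smul_mul_smul_comm, he.eq, h1, h2, h3, zero_smul, add_zero,
      zero_add, Matrix.mul_one, Matrix.one_mul]

/-- Unfolding `truncMonoidHom`. [folklore] -/
theorem truncMonoidHom_apply {e : R} (he : IsIdempotentElem e) (A : Matrix n n R) :
    truncMonoidHom he A = e • A + (1 - e) • (1 : Matrix n n R) := rfl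

/-- Truncating twice at `e` is truncating once. [folklore] -/
theorem truncMonoidHom_truncMonoidHom {e : R} (he : IsIdempotentElem e) (A : Matrix n n R) :
    truncMonoidHom he (truncMonoidHom he A) = truncMonoidHom he A := by
  simp only [truncMonoidHom_apply, smul_add, smul_smul, he.eq]
  rw [show e * (1 - e) = 0 by rw [mul_sub, mul_one, he.eq, sub_self], zero_smul, add_zero]

/-- Truncating at `e` after truncating at `1 - e` gives the identity matrix. [folklore] -/
theorem truncMonoidHom_truncMonoidHom_one_sub {e : R} (he : IsIdempotentElem e) (A : Matrix n n R) :
    truncMonoidHom he (truncMonoidHom he.one_sub A) = 1 := by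
  simp only [truncMonoidHom_apply, smul_add, smul_smul, sub_sub_cancel]
  rw [show e * (1 - e) = 0 by rw [mul_sub, mul_one, he.eq, sub_self], zero_smul, zero_add, he.eq,
    ← add_smul, add_sub_cancel, one_smul]

/-- The two truncations of `A` multiply back to `A`. [folklore] -/
theorem truncMonoidHom_mul_truncMonoidHom_one_sub {e : R} (he : IsIdempotentElem e)
    (A : Matrix n n R) : truncMonoidHom he A * truncMonoidHom he.one_sub A = A := by
  simp only [truncMonoidHom_apply, sub_sub_cancel]
  have h1 : e * (1 - e) = 0 := by rw [mul_sub, mul_one, he.eq, sub_self]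
  rw [add_mul, mul_add, mul_add, smul_mul_smul_comm, smul_mul_smul_comm, smul_mul_smul_comm,
    smul_mul_smul_comm, mul_comm (1 - e) e, h1, he.eq, (he.one_sub).eq, zero_smul, zero_smul,
    add_zero, zero_add, Matrix.mul_one, Matrix.one_mul, ← add_smul, add_sub_cancel, one_smul]

/-- Truncations at `e` and at `1 - e` commute with each other: `π_e(A) π_{1-e}(B) = π_{1-e}(B) π_e(A)`.
[folklore] -/
theorem truncMonoidHom_comm {e : R} (he : IsIdempotentElem e) (A B : Matrix n n R) :
    truncMonoidHom he A * truncMonoidHom he.one_sub B =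
      truncMonoidHom he.one_sub B * truncMonoidHom he A := by
  simp only [truncMonoidHom_apply, sub_sub_cancel]
  have h1 : e * (1 - e) = 0 := by rw [mul_sub, mul_one, he.eq, sub_self]
  have h2 : (1 - e) * e = 0 := by rw [mul_comm, h1]
  rw [add_mul, mul_add, mul_add, add_mul, mul_add, mul_add]
  simp only [smul_mul_smul_comm, Matrix.mul_one, Matrix.one_mul, h1, h2, he.eq, (he.one_sub).eq,
    zero_smul, zero_add, add_zero]
  abel

variable (n) in
/-- Truncation at `e` on `GL_n(R)` (`Units.map` of `truncMonoidHom`). [folklore] -/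
def truncGL {e : R} (he : IsIdempotentElem e) : GL n R →* GL n R :=
  Units.map (truncMonoidHom he)

/-- The matrix of a truncated invertible matrix. [folklore] -/
theorem coe_truncGL {e : R} (he : IsIdempotentElem e) (g : GL n R) :
    ((truncGL n he g : GL n R) : Matrix n n R) = e • (g : Matrix n n R) + (1 - e) • 1 := rfl

/-- `π_e ∘ π_e = π_e` on `GL_n`. [folklore] -/
theorem truncGL_truncGL {e : R} (he : IsIdempotentElem e) (g : GL n R) :
    truncGL n he (truncGL n he g) = truncGL n he g :=
  Units.ext (truncMonoidHom_truncMonoidHom he _)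

/-- `π_e ∘ π_{1-e} = 1` on `GL_n`. [folklore] -/
theorem truncGL_truncGL_one_sub {e : R} (he : IsIdempotentElem e) (g : GL n R) :
    truncGL n he (truncGL n he.one_sub g) = 1 :=
  Units.ext (truncMonoidHom_truncMonoidHom_one_sub he _)

/-- `π_e(g) π_{1-e}(g) = g`. [folklore] -/
theorem truncGL_mul_truncGL_one_sub {e : R} (he : IsIdempotentElem e) (g : GL n R) :
    truncGL n he g * truncGL n he.one_sub g = g :=
  Units.ext (truncMonoidHom_mul_truncMonoidHom_one_sub he _)

/-- `π_e(g)` and `π_{1-e}(h)` commute. [folklore] -/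
theorem truncGL_comm {e : R} (he : IsIdempotentElem e) (g h : GL n R) :
    truncGL n he g * truncGL n he.one_sub h = truncGL n he.one_sub h * truncGL n he g :=
  Units.ext (truncMonoidHom_comm he _ _)

/-- **`GL_n(R) ≅ GL_n(R)_e × GL_n(R)_{1-e}`**: the decomposition of `GL_n` over a ring with an
idempotent `e` as the internal direct product of the ranges of the two truncations (the
subgroups of matrices congruent to `1` modulo `1 - e`, resp. modulo `e`), `g ↦ (π_e g, π_{1-e} g)`
with inverse `(a, b) ↦ a b`. [folklore] -/
def truncGLEquiv {e : R} (he : IsIdempotentElem e) :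
    GL n R ≃* (truncGL n he).range × (truncGL n he.one_sub).range where
  toFun g := (⟨truncGL n he g, g, rfl⟩, ⟨truncGL n he.one_sub g, g, rfl⟩)
  invFun p := p.1.1 * p.2.1
  left_inv g := truncGL_mul_truncGL_one_sub he g
  right_inv p := by
    obtain ⟨⟨a, ga, rfl⟩, ⟨b, gb, rfl⟩⟩ := p
    ext1 <;> apply Subtype.ext <;> simp only [map_mul]
    · rw [truncGL_truncGL, truncGL_truncGL_one_sub, mul_one]
    · have := truncGL_truncGL_one_sub he.one_sub (n := n)
      simp only [sub_sub_cancel] at this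
      rw [truncGL_truncGL, this ga, one_mul]
  map_mul' g h := by
    ext1 <;> apply Subtype.ext <;> simp only [map_mul, Prod.fst_mul, Prod.snd_mul, Subgroup.coe_mul]

end Trunc

section Topology

variable {R : Type*} [CommRing R] [TopologicalSpace R] [IsTopologicalRing R]
  {n : Type*} [Fintype n] [DecidableEq n]

/-- Truncation is continuous on `GL_n(R)` (for the unit-group topologies). [folklore] -/
theorem continuous_truncGL {e : R} (he : IsIdempotentElem e) : Continuous (truncGL n he) := by
  refine Units.continuous_map ?_
  change Continuous fun A : Matrix n n R => e • A + (1 - e) • (1 : Matrix n n R)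
  fun_prop

/-- **`GL_n(R) ≅ GL_n(R)_e × GL_n(R)_{1-e}` as topological groups.** [folklore] -/
def truncGLContinuousEquiv {e : R} (he : IsIdempotentElem e) :
    GL n R ≃ₜ* (truncGL n he).range × (truncGL n he.one_sub).range where
  toMulEquiv := truncGLEquiv he
  continuous_toFun := by
    refine Continuous.prodMk ?_ ?_
    · exact (continuous_truncGL he).subtype_mk _
    · exact (continuous_truncGL he.one_sub).subtype_mk _
  continuous_invFun := by
    change Continuous fun p : (truncGL n he).range × (truncGL n he.one_sub).range =>
      (p.1.1 : GL n R) * p.2.1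
    fun_prop

end Topology

end Literature.LinearAlgebra.Matrix
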